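import Mathlib.RingTheory.RegularLocalRing.Polynomial
import Mathlib.RingTheory.Algebraic.Basic
import Mathlib.FieldTheory.IntermediateField.Adjoin.Algebra
import Summits.ResolutionOfSingularities.ResolutionOfSingularities.Theorems.AbhyankarShadowsShadowsUniformizePlaneRegularCentre
import Literature.AlgebraicGeometry.Resolution.LocalUniformizationDimOne
import Literature.AlgebraicGeometry.Resolution.LocalUniformization
import Literature.AlgebraicGeometry.Resolution.AffineDomainDimension
import Literature.AlgebraicGeometry.Resolution.ExcellentRingsFieldProofs
import Literature.AlgebraicGeometry.Resolution.KnafKuhlmann2009Assembly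
import HarnessLib

/-!
# A regular centre of dimension two for ruled function fields `F(x)` along every valuation (`stub_regularCentre_of_ruled`)

Stub of the birth line of the crux `ShadowsUniformize` (stmt-ResolutionOfSingularities-16756, route
`AbhyankarShadows`), regular-centre branch (lead c3, reshape #5b). The branch says: if a valuation
ring `O` of `K` contains a finitely generated model `B` (`Frac B = K`) whose local ring at the
centre `𝔪_O ∩ B` is regular of Krull dimension `≤ 2`, then relative local uniformization holds
along `O` (Abhyankar's union lemma, the neighbouring transfer stub). This file supplies such a
centre for EVERY valuation ring `O ∋ k` of a RULED function field `K = F(x)`: `F/k` finitely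
generated of transcendence degree `≤ 1`, `x` transcendental over `F`, `K` generated over `F` by
`x`.

* **Curves** (`exists_regularModel_of_trdeg_le_one`): every valuation ring `O_F ∋ k` of `F` has a
  finitely generated model `A ⊆ O_F`, `Frac A = F`, regular at the centre: take any affine model
  `A₀ ⊆ O_F` (`exists_affineModel`), of Krull dimension `≤ 1` (`dim = trdeg`); if the centre
  `𝔪_{O_F} ∩ A₀` is nonzero, local uniformization in dimension one (= finite normalization,
  `exists_closure_isRegularLocalRing_of_ringKrullDim_le_one`) gives `A = A₀[t]`; if it is zero,
  the local ring of `A₀` at the centre is the field `F`, regular.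
* **The ruled surface**: restrict `O` to `F` (`O_F = O ∩ F`, with the same centre condition
  `v < 1`, `comap_valuation_lt_one_iff` of `KnafKuhlmann2009Assembly.lean`), move the curve
  model `A` into `K` (`A₁`), put `x' := x` if `x ∈ O` and `x' := x⁻¹` otherwise, and
  `B := k[A₁ ∪ {x'}] = A₁[x'] ⊆ O`. Then `K = k(A₁ ∪ {x'})` (it contains `F = Frac A₁` and `x`),
  so `Frac B = K`
  (`isFractionRing_adjoin_of_adjoin_eq_top`); `x'` is transcendental over `F ⊇ A₁`, so
  `B ≅ A₁[X]` (`Polynomial.aeval x'`), of Krull dimension `dim A₁ + 1 ≤ 2`; and the local ring of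
  `A₁[X]` at a prime `𝔮` is regular as soon as `A₁` is regular at `𝔮 ∩ A₁`
  (`isRegularLocalRing_polynomial_localization_of_comap_C`, the proof of Mathlib's
  `Polynomial.isRegularRing_of_isRegularRing` run at one prime: `(A₁[X])_𝔮` is a localization of
  `D[X]`, `D = (A₁)_{𝔮 ∩ A₁}` regular local, at a prime over `𝔪_D`, and
  `Polynomial.isRegularLocalRing_localization_atPrime_of_comap_eq_maximalIdeal`). Here
  `𝔮 ∩ A₁` is the centre of `O` on `A₁`, i.e. of `O_F` on `A`.

Everything is proved; no named facts are used.

## Sources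

* O. Zariski, *The reduction of the singularities of an algebraic surface*, Ann. of Math. 40
  (1939) 639–689 (uniformization of valuations of a function field of a surface; the ruled case
  reduces to the curve `F`). [Zariski1939]
* H. Matsumura, *Commutative Ring Theory*, Thm. 19.5 (`R` regular ⇒ `R[X]` regular, via the
  localization at a prime over a maximal ideal) and Thm. 11.2 (normal of dimension one is
  regular). [Matsumura1987]
* J. Kollár, *Lectures on Resolution of Singularities*, Thm. 1.101 (finite normalization;
  resolution of curves). [Kollar2007]
-/

noncomputable section

-- single-problem summit: the doubled namespace component is forced
set_option linter.dupNamespace false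

open Literature.AlgebraicGeometry.Resolution IsLocalRing Polynomial

namespace Summit.ResolutionOfSingularities.ResolutionOfSingularities.Theorems

/-! ## Polynomial rings: regularity at a prime only needs regularity below it -/

/-- **A polynomial ring is regular at a prime `p` as soon as the base is regular at `p ∩ R`.**
For a prime `p ⊂ R[X]` with `q = p ∩ R`, `(R[X])_p` is the localization of `R_q[X]` at a prime
lying over the maximal ideal of the regular local ring `R_q`, hence regular
(`Polynomial.isRegularLocalRing_localization_atPrime_of_comap_eq_maximalIdeal`). This is the
proof of Mathlib's `Polynomial.isRegularRing_of_isRegularRing`, run at a single prime.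
[cite: Matsumura1987, Thm. 19.5] -/
theorem isRegularLocalRing_polynomial_localization_of_comap_C {R : Type*} [CommRing R]
    (p : Ideal R[X]) [p.IsPrime]
    (hreg : IsRegularLocalRing (Localization.AtPrime (p.comap (C : R →+* R[X])))) :
    IsRegularLocalRing (Localization.AtPrime p) := by
  -- adapted from Mathlib's `Polynomial.isRegularRing_of_isRegularRing`
  let q := p.comap (C : R →+* R[X])
  let S := (Localization.AtPrime q)[X]
  let pc := Submonoid.map (Polynomial.C : R →+* R[X]).toMonoidHom q.primeCompl
  letI : Algebra R[X] S := Polynomial.algebra R (Localization.AtPrime q)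
  haveI : IsLocalization pc S := Polynomial.isLocalization _ _
  let pS := p.map (algebraMap R[X] S)
  have disj : Disjoint (pc : Set R[X]) (p : Set R[X]) := by
    simpa [pc, q] using! Set.disjoint_image_left.mpr
      (Set.disjoint_compl_left_iff_subset.mpr (fun _ a ↦ a))
  haveI : pS.IsPrime := IsLocalization.isPrime_of_isPrime_disjoint pc _ _ ‹_› disj
  haveI : IsLocalization.AtPrime (Localization.AtPrime pS) p := by
    convert IsLocalization.isLocalization_isLocalization_atPrime_isLocalization pc
      (Localization.AtPrime pS) pS
    exact (IsLocalization.under_map_of_isPrime_disjoint pc _ ‹_› disj).symm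
  haveI : IsRegularLocalRing (Localization.AtPrime q) := hreg
  have eq : Ideal.comap C pS = maximalIdeal (Localization.AtPrime q) := by
    rw [← IsLocalization.map_under q.primeCompl _ (Ideal.comap C pS),
      ← IsLocalization.map_under q.primeCompl _ (maximalIdeal (Localization.AtPrime q))]
    simp only [Ideal.comap_comap, S, pS]
    rw [← Polynomial.algebraMap_eq (R := Localization.AtPrime q),
      ← IsScalarTower.algebraMap_eq R (Localization.AtPrime q) (Localization.AtPrime q)[X],
      IsScalarTower.algebraMap_eq R R[X] (Localization.AtPrime q)[X], ← Ideal.comap_comap,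
      ← Ideal.under_def R[X], IsLocalization.under_map_of_isPrime_disjoint pc _ ‹_› disj]
    simp [q, IsLocalization.AtPrime.under_maximalIdeal (Localization.AtPrime q) q]
  have := Polynomial.isRegularLocalRing_localization_atPrime_of_comap_eq_maximalIdeal _ pS eq
  exact IsRegularLocalRing.of_ringEquiv (R := Localization.AtPrime pS)
    (IsLocalization.algEquiv p.primeCompl (Localization.AtPrime pS) (Localization.AtPrime p)).toRingEquiv

/-- Regularity of the localization only depends on the prime ideal (transport along an equality
of ideals). [folklore] -/
private theorem isRegularLocalRing_atPrime_congr {A : Type*} [CommRing A] {I J : Ideal A}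
    [I.IsPrime] [J.IsPrime] (e : I = J) :
    IsRegularLocalRing (Localization.AtPrime I) ↔ IsRegularLocalRing (Localization.AtPrime J) := by
  subst e
  exact Iff.rfl

/-- The localization of a domain at the zero ideal (its fraction field) is a regular local ring.
[folklore] -/
private theorem isRegularLocalRing_localization_atPrime_of_eq_bot {A : Type*} [CommRing A]
    [IsDomain A] (I : Ideal A) [I.IsPrime] (hI : I = ⊥) :
    IsRegularLocalRing (Localization.AtPrime I) := by
  subst hI
  letI : Field (Localization.AtPrime (⊥ : Ideal A)) := IsField.toField <| by
    simp [isField_iff_maximalIdeal_eq, ← Localization.AtPrime.map_eq_maximalIdeal]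
  infer_instance

/-! ## Curves: a model regular at the centre of any valuation -/

/-- **Local uniformization of curves over an arbitrary ground field.** For a finitely generated
extension `L/k` of transcendence degree `≤ 1` and any valuation ring `O ∋ k` of `L` there is a
finitely generated `k`-subalgebra `A ⊆ O` with `Frac A = L`, of Krull dimension `≤ 1`, whose
local ring at the centre `𝔪_O ∩ A` is regular: start from any affine model `A₀ ⊆ O`
(`exists_affineModel`; `dim A₀ ≤ 1` as `dim = trdeg`); if the centre of `O` on `A₀` is nonzero,
local uniformization in dimension one (finite normalization of the excellent ring `A₀`,
`exists_closure_isRegularLocalRing_of_ringKrullDim_le_one`) provides `A = A₀[t] ⊆ O`; if it is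
zero, the local ring of `A₀` at the centre is the field `Frac A₀`, regular.
[cite: Kollar2007, Thm. 1.101] -/
theorem exists_regularModel_of_trdeg_le_one (k L : Type) [Field k] [Field L] [Algebra k L]
    (hfg : (⊤ : IntermediateField k L).FG) (h1 : Algebra.trdeg k L ≤ 1) (O : ValuationSubring L)
    (hk : ∀ c : k, algebraMap k L c ∈ O) :
    ∃ (A : Subalgebra k L) (h : A.toSubring ≤ O.toSubring), A.FG ∧ IsFractionRing A L ∧
      ringKrullDim A ≤ 1 ∧
      IsRegularLocalRing
        (Localization.AtPrime (Ideal.comap (Subring.inclusion h) (IsLocalRing.maximalIdeal O))) := by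
  classical
  obtain ⟨A₀, hA₀O, hA₀fg, hA₀frac⟩ := exists_affineModel k L hfg O hk
  haveI := hA₀frac
  have h1' : Algebra.trdeg k L ≤ ((1 : ℕ) : Cardinal) := by rwa [Nat.cast_one]
  have hdim_of : ∀ A : Subalgebra k L, A.FG → IsFractionRing A L → ringKrullDim A ≤ 1 := by
    intro A hA hAf
    haveI := hAf
    have := ringKrullDim_le_of_fg_of_trdeg_le A hA h1'
    rwa [Nat.cast_one] at this
  have hdim₀ : ringKrullDim A₀ ≤ 1 := hdim_of A₀ hA₀fg hA₀frac
  -- every element of `L` is a fraction of elements of `A₀`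
  have hdiv : ∀ z : L, ∃ a b : A₀, (b : L) ≠ 0 ∧ z = a / b := fun z => by
    obtain ⟨a, b, hb, hab⟩ := IsFractionRing.div_surjective (A := A₀) z
    exact ⟨a, b, fun hb0 => nonZeroDivisors.ne_zero hb (Subtype.ext hb0), hab.symm⟩
  by_cases hc : ∃ b : A₀, (b : L) ≠ 0 ∧ O.valuation (b : L) < 1
  · -- nonzero centre: local uniformization in dimension one
    obtain ⟨b, hb0, hvb⟩ := hc
    haveI : Algebra.FiniteType k A₀ := A₀.fg_iff_finiteType.mp hA₀fg
    have hexc : IsExcellentRing A₀.toSubring := isExcellentRing_of_finiteType_field k A₀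
    have hfrac : ∀ z : L, ∃ a s : A₀.toSubring, (s : L) ≠ 0 ∧ z * s = a := fun z => by
      obtain ⟨a, b, hb0, rfl⟩ := hdiv z
      exact ⟨⟨a, a.2⟩, ⟨b, b.2⟩, hb0, div_mul_cancel₀ _ hb0⟩
    obtain ⟨t, ht, hreg⟩ := exists_closure_isRegularLocalRing_of_ringKrullDim_le_one O
      A₀.toSubring hexc hdim₀ hA₀O hfrac (b := ⟨b, b.2⟩) hb0 hvb
    set A : Subalgebra k L := Algebra.adjoin k ((A₀ : Set L) ∪ ↑t) with hA
    have hA₀A : A₀ ≤ A := fun z hz => Algebra.subset_adjoin (Or.inl hz)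
    have hAeq : A.toSubring = Subring.closure ((A₀.toSubring : Set L) ∪ ↑t) := by
      rw [hA, Algebra.adjoin_eq_ring_closure]
      apply le_antisymm
      · refine Subring.closure_le.mpr ?_
        rintro z (⟨c, rfl⟩ | hz)
        · exact Subring.subset_closure (Or.inl (A₀.algebraMap_mem c))
        · exact Subring.subset_closure hz
      · exact Subring.closure_mono Set.subset_union_right
    have hAO : A.toSubring ≤ O.toSubring := (le_of_eq hAeq).trans ht
    have hAfg : A.FG := by
      rw [hA, Algebra.adjoin_union, Algebra.adjoin_eq]
      exact hA₀fg.sup (Subalgebra.fg_adjoin_finset t)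
    have hAfrac : IsFractionRing A L := IsFractionRing.of_field A L fun z => by
      obtain ⟨a, b, -, rfl⟩ := hdiv z
      exact ⟨⟨a, hA₀A a.2⟩, ⟨b, hA₀A b.2⟩, rfl⟩
    exact ⟨A, hAO, hAfg, hAfrac, hdim_of A hAfg hAfrac,
      (isRegularLocalRing_centre_congr hAeq hAO ht).mpr hreg⟩
  · -- zero centre: `Frac A₀ ⊆ O`, the local ring at the centre is the field `L`
    push Not at hc
    refine ⟨A₀, hA₀O, hA₀fg, hA₀frac, hdim₀, ?_⟩
    apply isRegularLocalRing_localization_atPrime_of_eq_bot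
    refine (Submodule.eq_bot_iff _).mpr fun b hb => ?_
    by_contra hb0
    have hb0' : ((b : A₀.toSubring) : L) ≠ 0 := fun h => hb0 (Subtype.ext h)
    rw [Ideal.mem_comap, ValuationSubring.valuation_lt_one_iff] at hb
    exact not_lt.mpr (hc ⟨b, b.2⟩ hb0') hb

/-! ## The ruled surface `F(x)`: the regular centre `A₁[x'] ⊆ O` -/

/-- **Every valuation ring `O ∋ k` of a ruled function field `K = F(x)` has a regular centre of
dimension `≤ 2` on an affine model.** For `F/k` finitely generated of transcendence degree `≤ 1`,
`x` transcendental over `F` with `K = F(x)`, and any valuation ring `O` of `K` containing `k`: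
with `A₁ ⊆ O ∩ F` a finitely generated model of `F` regular at the centre of `O ∩ F`
(`exists_regularModel_of_trdeg_le_one`) and `x' ∈ {x, x⁻¹} ∩ O`, the ring `B := A₁[x'] ⊆ O` is
finitely generated with `Frac B = K`, `B ≅ A₁[X]` has Krull dimension `≤ 2`, and its local ring at
the centre `𝔮 = 𝔪_O ∩ B` is regular, being a localization of `D[X]` (`D = (A₁)_{𝔮 ∩ A₁}` regular
local) at a prime over `𝔪_D`. [cite: Matsumura1987, Thm. 19.5] -/
theorem stub_regularCentre_of_ruled (k K : Type) [Field k] [Field K] [Algebra k K]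
    (F : IntermediateField k K) (hF : F.FG) (hF1 : Algebra.trdeg k F ≤ 1) (x : K)
    (hx : Transcendental F x) (hgen : IntermediateField.adjoin F {x} = ⊤)
    (O : ValuationSubring K) (hk : ∀ c : k, algebraMap k K c ∈ O) :
    ∃ (B : Subalgebra k K) (h : B.toSubring ≤ O.toSubring), B.FG ∧ IsFractionRing B K ∧
      IsRegularLocalRing
        (Localization.AtPrime (Ideal.comap (Subring.inclusion h) (IsLocalRing.maximalIdeal O))) ∧
      ringKrullDim
        (Localization.AtPrime (Ideal.comap (Subring.inclusion h) (IsLocalRing.maximalIdeal O))) ≤ 2 := by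
  classical
  /- Step 1: the valuation ring `O ∩ F` of `F` and a model `A` of the curve `F`, regular at its
  centre. -/
  have hkF : ∀ c : k, algebraMap k F c ∈ O.comap (algebraMap F K) := fun c => by
    rw [ValuationSubring.mem_comap, ← IsScalarTower.algebraMap_apply]
    exact hk c
  have hFtop : (⊤ : IntermediateField k F).FG :=
    IntermediateField.fg_top_iff.mpr (IntermediateField.essFiniteType_iff.mpr hF)
  obtain ⟨A, hAO, hAfg, hAfrac, hAdim, hAreg⟩ :=
    exists_regularModel_of_trdeg_le_one k F hFtop hF1 (O.comap (algebraMap F K)) hkF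
  haveI := hAfrac
  /- Step 2: move the model into `K`: `A₁ := A ⊆ F ⊆ K`. -/
  have hval : Function.Injective F.val := (F.val : F →+* K).injective
  set A₁ : Subalgebra k K := A.map F.val with hA₁
  have hA₁O : A₁.toSubring ≤ O.toSubring := by
    rintro _ ⟨a, ha, rfl⟩
    exact hAO ha
  have hA₁F : A₁ ≤ F.toSubalgebra := by
    rintro _ ⟨a, -, rfl⟩
    exact (a : F).2
  have hA₁fg : A₁.FG := hAfg.map F.val
  -- every element of `F` is a fraction of elements of `A₁`
  have hfracF : ∀ z ∈ F, ∃ a ∈ A₁, ∃ b ∈ A₁, z = a / b := by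
    intro z hz
    obtain ⟨a, b, -, hab⟩ := IsFractionRing.div_surjective (A := A) (⟨z, hz⟩ : F)
    refine ⟨F.val a, ⟨a, a.2, rfl⟩, F.val b, ⟨b, b.2, rfl⟩, ?_⟩
    have := congrArg (algebraMap F K) hab
    rw [map_div₀] at this
    exact this.symm
  -- `A₁ ≅ A` has Krull dimension `≤ 1`
  have hdimA₁ : ringKrullDim A₁ ≤ 1 := by
    rw [← ringKrullDim_eq_of_ringEquiv (A.equivMapOfInjective F.val hval).toRingEquiv]
    exact hAdim
  -- `A₁` is regular at the centre of `O` (the centre of `O ∩ F` on `A`, transported)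
  have hA₁reg : IsRegularLocalRing (Localization.AtPrime
      (Ideal.comap (Subring.inclusion hA₁O) (IsLocalRing.maximalIdeal O))) := by
    refine (isRegularLocalRing_localization_map_iff F.val O A
      (Ideal.comap (Subring.inclusion hAO) (maximalIdeal (O.comap (algebraMap F K)))) ?_
      (Ideal.comap (Subring.inclusion hA₁O) (maximalIdeal O)) ?_).mp hAreg
    · intro a
      rw [Ideal.mem_comap, ValuationSubring.valuation_lt_one_iff, comap_valuation_lt_one_iff]
      rfl
    · intro y
      rw [Ideal.mem_comap, ValuationSubring.valuation_lt_one_iff]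
      rfl
  /- Step 3: the generator `x' ∈ {x, x⁻¹} ∩ O` and the model `B := k[A₁ ∪ {x'}] = A₁[x']`. -/
  set x' : K := if x ∈ O then x else x⁻¹ with hx'def
  have hx'O : x' ∈ O := by
    by_cases hxO : x ∈ O
    · rw [hx'def, if_pos hxO]; exact hxO
    · rw [hx'def, if_neg hxO]; exact (O.mem_or_inv_mem x).resolve_left hxO
  have hx'T : Transcendental F x' := by
    by_cases hxO : x ∈ O
    · rw [hx'def, if_pos hxO]; exact hx
    · rw [hx'def, if_neg hxO]; exact fun h => hx (IsAlgebraic.inv_iff.mp h)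
  set B : Subalgebra k K := Algebra.adjoin k (insert x' (A₁ : Set K)) with hB
  have hA₁B : ∀ a ∈ A₁, a ∈ B := fun a ha => Algebra.subset_adjoin (Set.mem_insert_of_mem _ ha)
  have hx'B : x' ∈ B := Algebra.subset_adjoin (Set.mem_insert _ _)
  -- `B ⊆ O`
  let Oalg : Subalgebra k K := { O.toSubring with algebraMap_mem' := hk }
  have hBO' : B ≤ Oalg := Algebra.adjoin_le (Set.insert_subset hx'O fun y hy => hA₁O hy)
  have hBO : B.toSubring ≤ O.toSubring := fun y hy => hBO' hy
  -- `B` is finitely generated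
  have hBfg : B.FG := by
    obtain ⟨s, hs⟩ := hA₁fg
    rw [hB, ← hs, Algebra.adjoin_insert_adjoin, ← Finset.coe_insert]
    exact Subalgebra.fg_adjoin_finset _
  -- `K = k(A₁ ∪ {x'})`: it contains `F = Frac A₁` and `x`, and `K = F(x)`
  have hBtop : IntermediateField.adjoin k (insert x' (A₁ : Set K)) = ⊤ := by
    set E := IntermediateField.adjoin k (insert x' (A₁ : Set K)) with hE
    have hFE : F ≤ E := by
      intro z hz
      obtain ⟨a, ha, b, hb, rfl⟩ := hfracF z hz
      exact div_mem (IntermediateField.subset_adjoin k _ (Set.mem_insert_of_mem _ ha))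
        (IntermediateField.subset_adjoin k _ (Set.mem_insert_of_mem _ hb))
    have hx'E : x' ∈ E := IntermediateField.subset_adjoin k _ (Set.mem_insert _ _)
    have hxE : x ∈ E := by
      by_cases hxO : x ∈ O
      · rw [hx'def, if_pos hxO] at hx'E; exact hx'E
      · rw [hx'def, if_neg hxO] at hx'E; simpa using inv_mem hx'E
    rw [eq_top_iff]
    intro z _
    have hz : z ∈ IntermediateField.adjoin F {x} := by rw [hgen]; trivial
    have hle : IntermediateField.adjoin F {x} ≤ IntermediateField.extendScalars hFE :=
      IntermediateField.adjoin_le_iff.mpr (Set.singleton_subset_iff.mpr hxE)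
    exact hle hz
  have hBfrac : IsFractionRing B K := isFractionRing_adjoin_of_adjoin_eq_top hBtop
  /- Step 4: `B ≅ A₁[X]` through `Polynomial.aeval x'` (`x'` is transcendental over `A₁ ⊆ F`). -/
  have hx'A : Transcendental A₁ x' := hx'T.of_tower_top_of_subalgebra_le hA₁F
  let φ : A₁[X] →ₐ[A₁] K := Polynomial.aeval x'
  have hφinj : Function.Injective φ := transcendental_iff_injective.mp hx'A
  have hφmem : ∀ p : A₁[X], φ p ∈ B := fun p => by
    change Polynomial.aeval x' p ∈ B
    rw [Polynomial.aeval_eq_sum_range]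
    refine Subalgebra.sum_mem _ fun i _ => ?_
    rw [Algebra.smul_def]
    exact B.mul_mem (hA₁B _ (p.coeff i).2) (B.pow_mem hx'B i)
  let f : A₁[X] →+* B.toSubring := φ.toRingHom.codRestrict B.toSubring hφmem
  have hf : ∀ p : A₁[X], ((f p : B.toSubring) : K) = φ p := fun _ => rfl
  have hfinj : Function.Injective f := fun p q hpq => hφinj (by rw [← hf, ← hf, hpq])
  have hfsurj : Function.Surjective f := by
    have hrange : B ≤ φ.range.restrictScalars k := by
      refine Algebra.adjoin_le ?_
      rintro y hy
      rcases Set.mem_insert_iff.mp hy with rfl | hy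
      · exact ⟨X, Polynomial.aeval_X x'⟩
      · exact ⟨C ⟨y, hy⟩, Polynomial.aeval_C x' _⟩
    intro t
    obtain ⟨p, hp⟩ := (hrange t.2 : (t : K) ∈ φ.range.restrictScalars k)
    exact ⟨p, Subtype.ext hp⟩
  -- `dim B = dim A₁ + 1 ≤ 2`
  haveI : Algebra.FiniteType k A₁ := A₁.fg_iff_finiteType.mp hA₁fg
  haveI : IsNoetherianRing A₁ := Algebra.FiniteType.isNoetherianRing k A₁
  have hdimB : ringKrullDim B.toSubring ≤ 2 := by
    rw [← ringKrullDim_eq_of_ringEquiv (RingEquiv.ofBijective f ⟨hfinj, hfsurj⟩),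
      Polynomial.ringKrullDim_of_isNoetherianRing]
    calc ringKrullDim A₁ + 1 ≤ 1 + 1 := add_le_add hdimA₁ le_rfl
      _ = 2 := one_add_one_eq_two
  /- Step 5: regularity at the centre `𝔮 = 𝔪_O ∩ B`: `B_𝔮 ≅ (A₁[X])_𝔮` and `𝔮 ∩ A₁` is the centre
  of `O` on `A₁`. -/
  set 𝔮 : Ideal B.toSubring := Ideal.comap (Subring.inclusion hBO) (IsLocalRing.maximalIdeal O)
    with h𝔮
  haveI h𝔮p : 𝔮.IsPrime := Ideal.IsPrime.comap _
  have H : ∀ t : B.toSubring, ∃ a s : A₁[X], f s ∉ 𝔮 ∧ t * f s = f a := fun t => by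
    obtain ⟨p, hp⟩ := hfsurj t
    refine ⟨p, 1, ?_, ?_⟩
    · rw [map_one]; exact (Ideal.ne_top_iff_one 𝔮).mp h𝔮p.ne_top
    · rw [map_one, mul_one, hp]
  have hregB : IsRegularLocalRing (Localization.AtPrime 𝔮) := by
    refine (isRegularLocalRing_localization_comap_iff_of_sandwich f hfinj 𝔮 H).mp ?_
    haveI : (𝔮.comap f).IsPrime := Ideal.IsPrime.comap f
    apply isRegularLocalRing_polynomial_localization_of_comap_C
    have hPeq : (𝔮.comap f).comap (C : A₁ →+* A₁[X]) =
        Ideal.comap (Subring.inclusion hA₁O) (IsLocalRing.maximalIdeal O) := by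
      ext a
      rw [Ideal.mem_comap, Ideal.mem_comap, h𝔮, Ideal.mem_comap, Ideal.mem_comap]
      have : Subring.inclusion hBO (f (C a)) = Subring.inclusion hA₁O a :=
        Subtype.ext (by change φ (C a) = (a : K); exact Polynomial.aeval_C x' a)
      rw [this]
    exact (isRegularLocalRing_atPrime_congr hPeq).mpr hA₁reg
  refine ⟨B, hBO, hBfg, hBfrac, hregB, ?_⟩
  -- `dim B_𝔮 = ht 𝔮 ≤ dim B ≤ 2`
  rw [IsLocalization.AtPrime.ringKrullDim_eq_height 𝔮 (Localization.AtPrime 𝔮)]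
  exact le_trans Ideal.height_le_ringKrullDim_of_isPrime hdimB

end Summit.ResolutionOfSingularities.ResolutionOfSingularities.Theorems

end
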